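import Mathlib
import Literature.MathematicalPhysics.MHD.SolovevSolutions
import Literature.MathematicalPhysics.MHD.FluxSurfaceGeometry
import HarnessLib

/-!
# Near-axis (third-order) jets of the Pataki–Cerfon–Freidberg Solov'ev solution (proved)

For the PCF benchmark solution `Ψ = R⁴/8 + d₁ + d₂R² + d₃(R⁴ − 4R²Z²)` of `Δ*Ψ = R²`
(Pataki–Cerfon–Freidberg 2013 §6.1 — bib `PatakiCerfonFreidberg2013`; typed as `Solovev.psiPCF` with its
second-order axis data in `SolovevSolutions.lean`) this file PROVES the third-order jets
`Ψ_RRR = (3 + 24d₃)R`, `Ψ_RZZ = −16d₃R`, `Ψ_ZRR = −16d₃Z`, `Ψ_ZZZ = 0` (vocabulary of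
`FluxSurfaceGeometry.lean`: `dRRR`, `dRZZ`, `dZRR`, `dZZZ`), and, for a SHAPE-FITTED instance (midplane
constraints `Ψ(1±ε,0) = 0`, axis `R_a² = 1 + ε²`), the exact on-axis values
`Ψ_RR(R_a,0) = (1 + 8d₃)R_a²`, `Ψ_ZZ(R_a,0) = −8d₃R_a²` and the two DIMENSIONLESS near-axis shape ratios
`R_a Ψ_RRR/(6 Ψ_RR) = 1/2` and `R_a Ψ_RZZ/(2 Ψ_ZZ) = 1` — the inputs of any near-axis stability criterion
(flux-surface expansion to third order, e.g. Bateman, *MHD Instabilities* (1978) §7.3 eq. (7.3.3) — bib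
`Bateman1978`; the LADDER-GRIDFUSION cell reads these two ratios as Bateman's shift `S = −1/2` (hence
`d = 0`) and `eΔ = 1 + S` — that READING is the cell's derivation (pub/gridfusion/models/MODEL-5-NOTES.md
§6), recorded here only in this docstring; the theorems below are pure identities about `psiPCF`).
HONEST FRAMING: exact algebra about a MODEL equilibrium; no stability statement. Typer: gridfusion-model-5.
-/

noncomputable section

namespace Literature.MathematicalPhysics.MHD.Solovev

open GradShafranov FluxGeometry _root_.Real

/-- Derivative of the quadratic `a + b r²`. [folklore] -/
private theorem na_hasDerivAt_quad (a b r : ℝ) :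
    HasDerivAt (fun r => a + b * r ^ 2) (2 * b * r) r := by
  have h := (hasDerivAt_const r a).fun_add ((hasDerivAt_pow 2 r).const_mul b)
  exact h.congr_deriv (by norm_num; ring)

/-- `Ψ_RRR = (3 + 24d₃)R` for the PCF solution (any `Z`). [cite: PatakiCerfonFreidberg2013, §6.1] -/
theorem dRRR_psiPCF (d₁ d₂ d₃ R Z : ℝ) : dRRR (psiPCF d₁ d₂ d₃) R Z = (3 + 24 * d₃) * R := by
  unfold dRRR
  rw [show (3 : ℕ) = 2 + 1 from rfl, iteratedDeriv_succ]
  have h2 : iteratedDeriv 2 (fun r => psiPCF d₁ d₂ d₃ r Z)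
      = fun r => (2 * d₂ - 8 * d₃ * Z ^ 2) + (3 / 2 + 12 * d₃) * r ^ 2 := by
    funext r
    have := dRR_psiPCF d₁ d₂ d₃ r Z
    unfold dRR at this
    rw [this]; ring
  rw [h2, (na_hasDerivAt_quad _ _ R).deriv]
  ring

/-- `Ψ_RZZ = −16d₃R` for the PCF solution. [cite: PatakiCerfonFreidberg2013, §6.1] -/
theorem dRZZ_psiPCF (d₁ d₂ d₃ R Z : ℝ) : dRZZ (psiPCF d₁ d₂ d₃) R Z = -(16 * d₃ * R) := by
  unfold dRZZ
  rw [show (fun r => dZZ (psiPCF d₁ d₂ d₃) r Z) = fun r => 0 + -(8 * d₃) * r ^ 2 from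
    funext fun r => by rw [dZZ_psiPCF]; ring]
  rw [(na_hasDerivAt_quad _ _ R).deriv]
  ring

/-- `Ψ_ZRR = −16d₃Z` for the PCF solution. [cite: PatakiCerfonFreidberg2013, §6.1] -/
theorem dZRR_psiPCF (d₁ d₂ d₃ R Z : ℝ) : dZRR (psiPCF d₁ d₂ d₃) R Z = -(16 * d₃ * Z) := by
  unfold dZRR
  rw [show (fun z => dRR (psiPCF d₁ d₂ d₃) R z)
      = fun z => (3 * R ^ 2 / 2 + 2 * d₂ + 12 * d₃ * R ^ 2) + -(8 * d₃) * z ^ 2 from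
    funext fun z => by rw [dRR_psiPCF]; ring]
  rw [(na_hasDerivAt_quad _ _ Z).deriv]
  ring

/-- `Ψ_ZZZ = 0` for the PCF solution (`Ψ` is quadratic in `Z`). [cite: PatakiCerfonFreidberg2013, §6.1] -/
theorem dZZZ_psiPCF (d₁ d₂ d₃ R Z : ℝ) : dZZZ (psiPCF d₁ d₂ d₃) R Z = 0 := by
  unfold dZZZ
  rw [show (3 : ℕ) = 2 + 1 from rfl, iteratedDeriv_succ]
  have h2 : iteratedDeriv 2 (psiPCF d₁ d₂ d₃ R) = fun _ => -(8 * d₃ * R ^ 2) := by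
    funext z
    have := dZZ_psiPCF d₁ d₂ d₃ R z
    unfold dZZ at this
    exact this
  rw [h2, deriv_const]

/-- On-axis second derivatives of a SHAPE-FITTED PCF instance (`ε ≠ 0`, midplane constraints, axis
`R_a² = 1 + ε²`): `Ψ_RR(R_a,0) = (1 + 8d₃)R_a²` and `Ψ_ZZ(R_a,0) = −8d₃R_a²` — so the on-axis
elongation² `Ψ_RR/Ψ_ZZ = −(1+8d₃)/(8d₃)` depends on `d₃` alone. [cite: PatakiCerfonFreidberg2013, §6.1] -/
theorem psiPCF_axisHessian_fit {ε d₁ d₂ d₃ : ℝ} (hε : ε ≠ 0) (h₁ : psiPCF d₁ d₂ d₃ (1 + ε) 0 = 0)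
    (h₂ : psiPCF d₁ d₂ d₃ (1 - ε) 0 = 0) {Ra : ℝ} (hRa : Ra ^ 2 = 1 + ε ^ 2) :
    dRR (psiPCF d₁ d₂ d₃) Ra 0 = (1 + 8 * d₃) * Ra ^ 2 ∧ dZZ (psiPCF d₁ d₂ d₃) Ra 0 = -(8 * d₃ * Ra ^ 2) := by
  have hd₂ : d₂ = -(1 / 8 + d₃) * ((1 + ε) ^ 2 + (1 - ε) ^ 2) := by
    unfold psiPCF at h₁ h₂
    have h := sub_eq_zero.mpr (h₁.trans h₂.symm)
    have h' : 8 * ε * (d₂ + (1 / 8 + d₃) * ((1 + ε) ^ 2 + (1 - ε) ^ 2)) = 0 := by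
      linear_combination 2 * h
    have h8 : (8 : ℝ) * ε ≠ 0 := mul_ne_zero (by norm_num) hε
    linear_combination (mul_eq_zero.mp h').resolve_left h8
  obtain ⟨hRR, hZZ⟩ := psiPCF_axisHessian d₁ d₂ d₃ Ra
  refine ⟨?_, hZZ⟩
  rw [hRR, hd₂]
  have : (1 + ε) ^ 2 + (1 - ε) ^ 2 = 2 * Ra ^ 2 := by rw [hRa]; ring
  rw [this]; ring

/-- **Near-axis shape ratios of the shape-fitted PCF family (exact, shape-independent):**
`R_a·Ψ_RRR(R_a,0) = (6·(1/2))·Ψ_RR(R_a,0)` and `R_a·Ψ_RZZ(R_a,0) = 2·Ψ_ZZ(R_a,0)`, i.e. the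
dimensionless ratios `R_aΨ_RRR/(6Ψ_RR) = 1/2` and `R_aΨ_RZZ/(2Ψ_ZZ) = 1` whenever the denominators are
non-zero (the LADDER-GRIDFUSION reading: Bateman (7.3.3) shift `S = −1/2`, `d = 0`, `eΔ = 1/2`).
[cite: PatakiCerfonFreidberg2013, §6.1] -/
theorem psiPCF_nearAxisRatios {ε d₁ d₂ d₃ : ℝ} (hε : ε ≠ 0) (h₁ : psiPCF d₁ d₂ d₃ (1 + ε) 0 = 0)
    (h₂ : psiPCF d₁ d₂ d₃ (1 - ε) 0 = 0) {Ra : ℝ} (hRa : Ra ^ 2 = 1 + ε ^ 2) :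
    Ra * dRRR (psiPCF d₁ d₂ d₃) Ra 0 = 3 * dRR (psiPCF d₁ d₂ d₃) Ra 0 ∧
      Ra * dRZZ (psiPCF d₁ d₂ d₃) Ra 0 = 2 * dZZ (psiPCF d₁ d₂ d₃) Ra 0 := by
  obtain ⟨hRR, hZZ⟩ := psiPCF_axisHessian_fit hε h₁ h₂ hRa
  rw [hRR, hZZ, dRRR_psiPCF, dRZZ_psiPCF]
  constructor <;> ring

end Literature.MathematicalPhysics.MHD.Solovev
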